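import Summits.KontsevichZagierPeriods.KontsevichZagierPeriods.Theorems.CompleteModGammaSector.Negative.Admissible
import Summits.KontsevichZagierPeriods.KontsevichZagierPeriods.Theorems.CompleteModGammaSector.Negative.RealPrimitiveBarrier
import Summits.KontsevichZagierPeriods.KontsevichZagierPeriods.Theorems.CompleteModGammaSector.Negative.CdfNewtonLeibnizZero

/-!
# `CompleteModGammaSector` — negative side III: CHANGE OF VARIABLES is load-bearing, even modulo every Γ-Hodge pair

Landed copy of §§5E–5G of `Cruxes/CompleteModGammaSector/Disproof.lean` (cdisprove, gen 1). The
admissible subgroup `covKer` (formal combinations whose first-coordinate distribution function is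
`ℝ`-semialgebraic on the window `q ∈ [2,3]`) contains rules (1a), (1b), (3)
(`rulesOneThree_le_covKer`) and every Γ-Hodge pair (`pairHyp_covKer`: both domains live over first
coordinates `< 1`, so their `Cdf` is constant on the window), but not the rational pair
`r₀ = [[0,1], 1/(2−t)]`, `r₀' = [[2,3], 1/(4−t)]` — ONE translation (`witness_mem_changeOfVariablesRel`),
value `log 2` on both sides: its `Cdf` on the window is `log (2 − s) + C`, and `1/(s − 2)` has no
`ℝ`-semialgebraic primitive (`noRealSemialgebraicPrimitive_inv_sub_two`).

* `completeModGammaSector_false_without_changeOfVariables`;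
* `not_periodConjecture_rulesOneThree` — summit level: additivity + Newton–Leibniz alone do not
  give Conjecture 1;
* `witness_cov_mem_sector` — the pair is a true instance of the crux.
-/

noncomputable section

open MeasureTheory Set
open scoped BigOperators Topology

namespace Summit.KontsevichZagierPeriods.CompleteModGammaSectorNegative

open Literature.NumberTheory.Transcendental
open Literature.NumberTheory.Transcendental.KZ
open Literature.ModelTheory.ExponentialFields (IsSemialgebraic)
open Summit.KontsevichZagierPeriods.KontsevichZagierPeriods.Theses.TerasomaMultiplication
  (CompleteModGammaSector GammaHodgeSector closes)
open Summit.KontsevichZagierPeriods.GammaHodgeSectorNegative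
open Literature.Barriers.KontsevichZagierPeriods.KZ (constRep constRep_value constRep_isRational)

/-! ### §5F The witness: ONE translation, `∫₀¹ dt/(2−t) = ∫₂³ dt/(4−t)` -/

/-- The band `{a ≤ x₀ ≤ b} ⊆ ℝ¹` with rational ends is `ℚ`-semialgebraic. [folklore] -/
theorem isSemialgebraic_band (a b : ℚ) :
    IsSemialgebraic ℚ {x : Fin 1 → ℝ | (a : ℝ) ≤ x 0 ∧ x 0 ≤ b} := by
  have h : {x : Fin 1 → ℝ | (a : ℝ) ≤ x 0 ∧ x 0 ≤ b} =
      {x : Fin 1 → ℝ | MvPolynomial.aeval x (MvPolynomial.C a : MvPolynomial (Fin 1) ℚ) ≤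
          MvPolynomial.aeval x (MvPolynomial.X 0 : MvPolynomial (Fin 1) ℚ)} ∩
        {x | MvPolynomial.aeval x (MvPolynomial.X 0 : MvPolynomial (Fin 1) ℚ) ≤
          MvPolynomial.aeval x (MvPolynomial.C b : MvPolynomial (Fin 1) ℚ)} := by
    ext x
    simp
  rw [h]
  exact (Literature.ModelTheory.ExponentialFields.isSemialgebraic_setOf_eval_le _ _).inter
    (Literature.ModelTheory.ExponentialFields.isSemialgebraic_setOf_eval_le _ _)

/-- The band `{a ≤ x₀ ≤ b} ⊆ ℝ¹` is compact. [folklore] -/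
theorem isCompact_band (a b : ℝ) : IsCompact {x : Fin 1 → ℝ | a ≤ x 0 ∧ x 0 ≤ b} := by
  convert isCompact_univ_pi (fun _ : Fin 1 => (isCompact_Icc : IsCompact (Icc a b))) using 1
  ext x
  simp [Set.pi, Fin.forall_fin_one]

/-- `1/(c − x₀)` is integrable on the band `[a,b]` when `b < c`. [folklore] -/
theorem integrableOn_inv_sub (a b c : ℚ) (hbc : (b : ℝ) < c) :
    IntegrableOn (fun x : Fin 1 → ℝ =>
      MvPolynomial.aeval x (1 : MvPolynomial (Fin 1) ℚ) /
        MvPolynomial.aeval x (MvPolynomial.C c - MvPolynomial.X 0 : MvPolynomial (Fin 1) ℚ))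
      {x : Fin 1 → ℝ | (a : ℝ) ≤ x 0 ∧ x 0 ≤ b} := by
  have hfun : (fun x : Fin 1 → ℝ => MvPolynomial.aeval x (1 : MvPolynomial (Fin 1) ℚ) /
        MvPolynomial.aeval x (MvPolynomial.C c - MvPolynomial.X 0 : MvPolynomial (Fin 1) ℚ)) =
      fun x => 1 / ((c : ℝ) - x 0) := by
    funext x
    simp
  rw [hfun]
  refine ContinuousOn.integrableOn_compact (isCompact_band _ _) ?_
  refine continuousOn_const.div (continuousOn_const.sub (continuous_apply 0).continuousOn) ?_
  intro x hx
  have : x 0 ≤ b := hx.2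
  exact sub_ne_zero.mpr (by intro h; linarith)

/-- The denominator `c − x₀` does not vanish on the band `[a,b]` when `b < c`. [folklore] -/
theorem aeval_sub_ne_zero (a b c : ℚ) (hbc : (b : ℝ) < c) :
    ∀ x ∈ {x : Fin 1 → ℝ | (a : ℝ) ≤ x 0 ∧ x 0 ≤ b},
      MvPolynomial.aeval x (MvPolynomial.C c - MvPolynomial.X 0 : MvPolynomial (Fin 1) ℚ) ≠ 0 := by
  intro x hx
  have : x 0 ≤ b := hx.2
  simp only [map_sub, MvPolynomial.aeval_C, MvPolynomial.aeval_X, eq_ratCast, ne_eq]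
  intro h
  linarith

/-- `r₀ = [[0,1], 1/(2 − t)]` (value `log 2`), of KZ's literal shape. -/
def r₀ : IntegralRep 1 :=
  IntegralRep.ofRational {x : Fin 1 → ℝ | ((0 : ℚ) : ℝ) ≤ x 0 ∧ x 0 ≤ (1 : ℚ)} 1
    (MvPolynomial.C 2 - MvPolynomial.X 0) (isSemialgebraic_band 0 1)
    (aeval_sub_ne_zero 0 1 2 (by norm_num)) (integrableOn_inv_sub 0 1 2 (by norm_num))

/-- `r₀' = [[2,3], 1/(4 − t)]` (value `log 2`), of KZ's literal shape: the translate of `r₀` by `2`. -/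
def r₀' : IntegralRep 1 :=
  IntegralRep.ofRational {x : Fin 1 → ℝ | ((2 : ℚ) : ℝ) ≤ x 0 ∧ x 0 ≤ (3 : ℚ)} 1
    (MvPolynomial.C 4 - MvPolynomial.X 0) (isSemialgebraic_band 2 3)
    (aeval_sub_ne_zero 2 3 4 (by norm_num)) (integrableOn_inv_sub 2 3 4 (by norm_num))

/-- `r₀` has KZ's literal (rational) shape. [folklore] -/
theorem r₀_isRational : r₀.IsRational := IntegralRep.isRational_ofRational _ _ _ _ _ _

/-- `r₀'` has KZ's literal (rational) shape. [folklore] -/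
theorem r₀'_isRational : r₀'.IsRational := IntegralRep.isRational_ofRational _ _ _ _ _ _

/-- The domain of `r₀` is the band `[0,1]`. [folklore] -/
theorem r₀_domain : r₀.domain = {x : Fin 1 → ℝ | (0 : ℝ) ≤ x 0 ∧ x 0 ≤ 1} := by
  show {x : Fin 1 → ℝ | ((0 : ℚ) : ℝ) ≤ x 0 ∧ x 0 ≤ (1 : ℚ)} = _
  simp

/-- The domain of `r₀'` is the band `[2,3]`. [folklore] -/
theorem r₀'_domain : r₀'.domain = {x : Fin 1 → ℝ | (2 : ℝ) ≤ x 0 ∧ x 0 ≤ 3} := by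
  show {x : Fin 1 → ℝ | ((2 : ℚ) : ℝ) ≤ x 0 ∧ x 0 ≤ (3 : ℚ)} = _
  simp

/-- The integrand of `r₀` is `1/(2 − x₀)`. [folklore] -/
theorem r₀_integrand (x : Fin 1 → ℝ) : r₀.integrand x = 1 / (2 - x 0) := by
  show MvPolynomial.aeval x (1 : MvPolynomial (Fin 1) ℚ) /
    MvPolynomial.aeval x (MvPolynomial.C 2 - MvPolynomial.X 0 : MvPolynomial (Fin 1) ℚ) = _
  simp

/-- The integrand of `r₀'` is `1/(4 − x₀)`. [folklore] -/
theorem r₀'_integrand (x : Fin 1 → ℝ) : r₀'.integrand x = 1 / (4 - x 0) := by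
  show MvPolynomial.aeval x (1 : MvPolynomial (Fin 1) ℚ) /
    MvPolynomial.aeval x (MvPolynomial.C 4 - MvPolynomial.X 0 : MvPolynomial (Fin 1) ℚ) = _
  simp

/-- **The witness pair is ONE move of rule (2)**: the translation `t ↦ t + 2` carries
`[[0,1], 1/(2−t)]` to `[[2,3], 1/(4−t)]`. [cite: KontsevichZagier2001, §1.2 rule (2)] -/
theorem witness_mem_changeOfVariablesRel : of r₀ - of r₀' ∈ changeOfVariablesRel := by
  refine ⟨1, r₀, r₀', fun x => x + fun _ => (2 : ℝ), fun _ => ContinuousLinearMap.id ℝ (Fin 1 → ℝ),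
    ?_, ?_, ?_, ?_, ?_, rfl⟩
  · refine (isSemialgebraicMapOn_aeval r₀.isSemialgebraic_domain
      (fun _ => (MvPolynomial.X 0 + MvPolynomial.C 2 : MvPolynomial (Fin 1) ℚ))).congr ?_
    intro x _
    funext j
    rw [Subsingleton.elim j 0]
    simp
  · intro x _
    exact (hasFDerivWithinAt_id x _).add_const _
  · intro x _ y _ h
    exact add_right_cancel h
  · rw [r₀_domain, r₀'_domain]
    ext y
    simp only [mem_setOf_eq, mem_image]
    constructor
    · rintro ⟨h1, h2⟩
      refine ⟨y - fun _ => (2 : ℝ), ⟨?_, ?_⟩, ?_⟩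
      · simp only [Pi.sub_apply]
        linarith
      · simp only [Pi.sub_apply]
        linarith
      · simp
    · rintro ⟨x, ⟨h1, h2⟩, rfl⟩
      simp only [Pi.add_apply]
      constructor <;> linarith
  · intro x _
    rw [r₀_integrand, r₀'_integrand]
    simp only [Pi.add_apply, ContinuousLinearMap.det, ContinuousLinearMap.coe_id, LinearMap.det_id,
      abs_one, mul_one]
    ring

/-- Hence the witness pair represents the same number (soundness of rule (2)). [folklore] -/
theorem r₀_value_eq : r₀.value = r₀'.value := by
  have h := eval_eq_zero_of_mem_changeOfVariablesRel_holds witness_mem_changeOfVariablesRel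
  rwa [eval_of_sub_of, sub_eq_zero] at h

/-- … and is a TRUE instance of the crux: `[r₀] − [r₀'] ∈ relations`. [folklore] -/
theorem witness_mem_relations : of r₀ - of r₀' ∈ relations :=
  changeOfVariablesRel_subset_relations witness_mem_changeOfVariablesRel

/-- `Cdf [r₀]` is constant `= r₀.value` on the window. [folklore] -/
theorem Cdf_r₀ {s : ℝ} (hs : s ∈ Icc (0 : ℝ) 1) : Cdf (of r₀) (2 + s) = r₀.value := by
  refine Cdf_of_eq_value one_pos r₀ _ fun x hx => ?_
  rw [r₀_domain] at hx
  have h1 : x 0 ≤ 1 := hx.2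
  have h0 : (⟨0, one_pos⟩ : Fin 1) = 0 := rfl
  rw [h0]
  linarith [hs.1]

/-- `Cdf [r₀'] (2 + s) = −log (2 − s) + log 2` on the window (FTC with the transcendental
primitive `−log (4 − t)`). [folklore] -/
theorem Cdf_r₀' {s : ℝ} (hs : s ∈ Icc (0 : ℝ) 1) :
    Cdf (of r₀') (2 + s) = -Real.log (2 - s) + Real.log 2 := by
  have hcont : ContinuousOn (fun t : ℝ => -Real.log (4 - t)) (Icc 2 3) := by
    refine ContinuousOn.neg (ContinuousOn.log (f := fun t : ℝ => 4 - t)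
      (continuousOn_const.sub continuousOn_id) ?_)
    intro t ht h
    have h3 : t ≤ 3 := ht.2
    have h' : (4 : ℝ) - t = 0 := h
    linarith
  have hderiv : ∀ t ∈ Ioo (2 : ℝ) 3, HasDerivAt (fun t : ℝ => -Real.log (4 - t))
      (r₀'.integrand (fun _ => t)) t := by
    intro t ht
    have hi : r₀'.integrand (fun _ => t) = 1 / (4 - t) := r₀'_integrand _
    rw [hi]
    have h4 : (4 : ℝ) - t ≠ 0 := by
      have := ht.2
      linarith
    have h : HasDerivAt (fun t : ℝ => -Real.log (4 - t)) (-((0 - 1) / (4 - t))) t :=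
      (((hasDerivAt_const t (4 : ℝ)).sub (hasDerivAt_id t)).log h4).neg
    exact h.congr_deriv (by ring)
  have hint : IntegrableOn r₀'.integrand {z : Fin 1 → ℝ | (2 : ℝ) ≤ z 0 ∧ z 0 ≤ 3} :=
    r₀'_domain ▸ r₀'.integrableOn
  rw [Cdf_of_succ, r₀'_domain, setIntegral_band_fin_one (by norm_num) hint hcont hderiv (2 + s)]
  have hmin : min (2 + s) (3 : ℝ) = 2 + s := min_eq_left (by linarith [hs.2])
  have hmax : max (2 : ℝ) (2 + s) = 2 + s := max_eq_right (by linarith [hs.1])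
  rw [hmin, hmax]
  have h1 : (4 : ℝ) - (2 + s) = 2 - s := by ring
  have h2 : (4 : ℝ) - 2 = 2 := by norm_num
  simp only [h1, h2, sub_neg_eq_add]

/-- **The witness is separated**: `[r₀] − [r₀'] ∉ covKer`, because on the window its
distribution function is `r₀.value + log (2 − s) − log 2`, whose derivative `1/(s − 2)` has no
`ℝ`-semialgebraic primitive (`noRealSemialgebraicPrimitive_inv_sub_two`). [folklore] -/
theorem witness_not_mem_covKer : of r₀ - of r₀' ∉ covKer := by
  rintro ⟨G, hG, hgG⟩
  have hformula : ∀ s ∈ Icc (0 : ℝ) 1,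
      G (fun _ => s) = r₀.value + Real.log (2 - s) - Real.log 2 := by
    intro s hs
    rw [← hgG s hs, map_sub, Pi.sub_apply, Cdf_r₀ hs, Cdf_r₀' hs]
    ring
  refine noRealSemialgebraicPrimitive_inv_sub_two ⟨G, hG, fun t ht => ?_⟩
  have h2 : (2 : ℝ) - t ≠ 0 := by
    have := ht.2
    intro h
    linarith
  have h2' : t - (2 : ℝ) ≠ 0 := by
    have := ht.2
    intro h
    linarith
  have hd : HasDerivAt (fun s : ℝ => r₀.value + Real.log (2 - s) - Real.log 2)
      (0 + (0 - 1) / (2 - t) - 0) t :=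
    ((hasDerivAt_const t _).add (((hasDerivAt_const t (2 : ℝ)).sub (hasDerivAt_id t)).log h2)).sub
      (hasDerivAt_const t _)
  have hval : (0 : ℝ) + (0 - 1) / (2 - t) - 0 = 1 / (t - 2) := by
    field_simp
    ring
  rw [hval] at hd
  refine hd.congr_of_eventuallyEq (Filter.eventuallyEq_of_mem (Icc_mem_nhds ht.1 ht.2) ?_)
  intro s hs
  exact hformula s hs


/-! ### §5E Every Γ-Hodge pair is window-semialgebraic (indeed constant on the window) -/

/-- **The Γ-sector is invisible to the invariant.** Both representations of a Γ-Hodge pair have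
all first coordinates `< 1 ≤ 2`, so on the window `q ∈ [2,3]` their distribution functions are the
constants `ρ.value`, `ρ'.value` (or `0` in dimension `0`): `Cdf ([ρ] − [ρ'])` is constant there.
[folklore] -/
theorem windowSemialg_Cdf_pair {N N' k : ℕ} (ρ : IntegralRep N) (ρ' : IntegralRep (2 * k + N'))
    (hd : ρ.domain = {t | ∀ j, t j ∈ Set.Ioo (0:ℝ) 1})
    (hd' : ρ'.domain = {z | (∑ i : Fin (2 * k), (z (Fin.castAdd N' i)) ^ 2) < 1 ∧
      ∀ l : Fin N', z (Fin.natAdd (2 * k) l) ∈ Set.Ioo (0:ℝ) 1}) :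
    WindowSemialg (Cdf (of ρ - of ρ')) := by
  have h1 : ∃ c₁ : ℝ, ∀ s ∈ Icc (0:ℝ) 1, Cdf (of ρ) (2 + s) = c₁ := by
    rcases Nat.eq_zero_or_pos N with hN | hN
    · exact ⟨0, fun s _ => by rw [Cdf_of_eq_zero hN]; rfl⟩
    · refine ⟨ρ.value, fun s hs => Cdf_of_eq_value hN ρ _ fun x hx => ?_⟩
      rw [hd] at hx
      have hx1 := (hx ⟨0, hN⟩).2
      linarith [hs.1]
  have h2 : ∃ c₂ : ℝ, ∀ s ∈ Icc (0:ℝ) 1, Cdf (of ρ') (2 + s) = c₂ := by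
    rcases Nat.eq_zero_or_pos (2 * k + N') with hN | hN
    · exact ⟨0, fun s _ => by rw [Cdf_of_eq_zero hN]; rfl⟩
    · refine ⟨ρ'.value, fun s hs => Cdf_of_eq_value hN ρ' _ fun z hz => ?_⟩
      rw [hd'] at hz
      obtain ⟨hball, hcube⟩ := hz
      have hz0 : z ⟨0, hN⟩ < 1 := by
        rcases Nat.eq_zero_or_pos k with hk | hk
        · subst hk
          have hN' : 0 < N' := by omega
          have h := (hcube ⟨0, hN'⟩).2
          have heq : (Fin.natAdd (2 * 0) ⟨0, hN'⟩ : Fin (2 * 0 + N')) = ⟨0, hN⟩ := Fin.ext (by simp)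
          rwa [heq] at h
        · have hk2 : 0 < 2 * k := by omega
          have hle : (z (Fin.castAdd N' ⟨0, hk2⟩)) ^ 2 ≤ ∑ i : Fin (2 * k), (z (Fin.castAdd N' i)) ^ 2 :=
            Finset.single_le_sum (f := fun i => (z (Fin.castAdd N' i)) ^ 2) (fun i _ => sq_nonneg _)
              (Finset.mem_univ _)
          have heq : (Fin.castAdd N' ⟨0, hk2⟩ : Fin (2 * k + N')) = ⟨0, hN⟩ := Fin.ext rfl
          rw [heq] at hle
          have hsq : (z ⟨0, hN⟩) ^ 2 < 1 := lt_of_le_of_lt hle hball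
          by_contra hge
          have hge' : 1 ≤ z ⟨0, hN⟩ := not_lt.mp hge
          nlinarith [hsq, hge']
      linarith [hs.1]
  obtain ⟨c₁, hc₁⟩ := h1
  obtain ⟨c₂, hc₂⟩ := h2
  exact WindowSemialg.of_const (c₁ - c₂) fun s hs => by rw [map_sub, Pi.sub_apply, hc₁ s hs, hc₂ s hs]

/-! ### §5G Assembly: rule (2) is load-bearing modulo rules (1), (3) and every Γ-Hodge pair -/

/-- The subgroup generated by rules (1a), (1b), (3) — everything except change of variables. -/
def rulesOneThree : AddSubgroup FormalRep :=
  AddSubgroup.closure (domainAddRel ∪ integrandAddRel ∪ newtonLeibnizRel)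

/-- `rulesOneThree ≤ relations`. [folklore] -/
theorem rulesOneThree_le_relations : rulesOneThree ≤ relations := by
  unfold rulesOneThree relations
  refine AddSubgroup.closure_mono ?_
  rintro c ((hc | hc) | hc)
  · exact Or.inl (Or.inl (Or.inl hc))
  · exact Or.inl (Or.inl (Or.inr hc))
  · exact Or.inr hc

/-- **Every Newton–Leibniz move lies in `covKer`.** [cite: KontsevichZagier2001, §1.2 rule (3)] -/
theorem newtonLeibnizRel_subset_covKer : newtonLeibnizRel ⊆ (covKer : Set FormalRep) := by
  rintro c ⟨n, r, r', a, b, F, hF, -, -, hab, hdom, hcont, hderiv, hr', rfl⟩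
  cases n with
  | zero => exact windowSemialg_Cdf_newtonLeibniz_zero r r' hF hab hdom hcont hderiv
  | succ m =>
    show WindowSemialg (Cdf (of r - of r'))
    rw [map_sub, Cdf_eq_of_newtonLeibniz_succ r r' hab hdom hcont hderiv hr', sub_self]
    exact WindowSemialg.zero

/-- **Rules (1a), (1b), (3) preserve the invariant.** [folklore] -/
theorem rulesOneThree_le_covKer : rulesOneThree ≤ covKer := by
  refine (AddSubgroup.closure_le _).mpr ?_
  rintro c ((hc | hc) | hc)
  · exact closure_add_le_covKer (AddSubgroup.subset_closure (Or.inl hc))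
  · exact closure_add_le_covKer (AddSubgroup.subset_closure (Or.inr hc))
  · exact newtonLeibnizRel_subset_covKer hc

/-- **Every Γ-Hodge pair preserves the invariant**: `covKer` satisfies the pair hypothesis of the
crux (no Hodge test, algebraicity or value equality is even needed — only the shape of the two
domains). [folklore] -/
theorem pairHyp_covKer : PairHyp covKer := by
  intro N N' k x y x' y' c _ _ _ _ ρ ρ' hd _ hd' _ _
  exact windowSemialg_Cdf_pair ρ ρ' hd hd'

/-- The closure of the Γ-Hodge pairs lies in `covKer`. [folklore] -/
theorem closure_gammaHodgePairs_le_covKer : AddSubgroup.closure gammaHodgePairs ≤ covKer :=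
  (pairHyp_iff_closure_le _).mp pairHyp_covKer

/-- The crux with `relations` SHRUNK to rules (1), (3) (change of variables removed; the Γ-Hodge
pairs kept; negative knowledge, not a citable statement). -/
def CompleteModGammaSectorWithoutChangeOfVariables : Prop :=
  ∀ H : AddSubgroup FormalRep, rulesOneThree ≤ H → PairHyp H →
    ∀ ⦃n m : ℕ⦄ (r : IntegralRep n) (r' : IntegralRep m),
      r.IsRational → r'.IsRational → r.value = r'.value → of r - of r' ∈ H

/-- **CHANGE OF VARIABLES IS LOAD-BEARING, even modulo every Γ-Hodge identity.** The admissible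
subgroup `H = covKer` (formal combinations whose first-coordinate distribution function is
`ℝ`-semialgebraic on the window `[2,3]`) contains rules (1a), (1b), (3) and all Γ-Hodge pairs, but
not the rational pair `∫₀¹ dt/(2−t) = ∫₂³ dt/(4−t)` (`= log 2`): its distribution function on the
window is `log (2 − s) + const`, and `1/(s − 2)` has no semialgebraic primitive (Ayoub–Fresán, the
tree's barrier, here over real coefficients). Any proof of the crux must use rule (2) — already to
TRANSLATE a domain. Dually to `completeModGammaSector_false_without_newtonLeibniz`: rules (2) and
(3) are independent of each other over (1) + Γ-pairs. [cite: Ayoub2015, Rem. 1.2]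
[cite: KontsevichZagier2001, §1.2] -/
theorem completeModGammaSector_false_without_changeOfVariables :
    ¬ CompleteModGammaSectorWithoutChangeOfVariables := fun h =>
  witness_not_mem_covKer (h covKer rulesOneThree_le_covKer pairHyp_covKer r₀ r₀' r₀_isRational
    r₀'_isRational r₀_value_eq)

/-- **Corollary at summit level: rules (1) and (3) alone do not give Conjecture 1** — the
`ℤ`-span of additivity and Newton–Leibniz moves misses the translation pair (a fortiori, without
any Γ-pairs). [cite: KontsevichZagier2001, §1.2 Conjecture 1] -/
theorem not_periodConjecture_rulesOneThree :
    ¬ ∀ ⦃n m : ℕ⦄ (r : IntegralRep n) (r' : IntegralRep m),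
      r.IsRational → r'.IsRational → r.value = r'.value → of r - of r' ∈ rulesOneThree := fun h =>
  witness_not_mem_covKer (rulesOneThree_le_covKer (h r₀ r₀' r₀_isRational r₀'_isRational r₀_value_eq))

/-- NON-VACUITY: the witness pair is a TRUE instance of the crux (`∈ relations ≤ sector`, one
rule-(2) move), so it refutes only the CoV-free strengthening. [folklore] -/
theorem witness_cov_mem_sector : of r₀ - of r₀' ∈ sector :=
  AddSubgroup.mem_sup_left witness_mem_relations

end Summit.KontsevichZagierPeriods.CompleteModGammaSectorNegative
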